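import Mathlib
import HarnessLib
import Summits.CriticalPhenomena.PercolationContinuityZ3.Theses.PercLowPointHalfSpace
import Literature.Probability.Percolation.RSW

/-!
# Crux `LowPointBookkeeping` (stmt-CriticalPhenomena-14713), line `SketchIdeator4`: the dyadic stem criterion

Helper file for the crux item `stmt-CriticalPhenomena-14713` (`LowPointBookkeeping`, K) of route
`CriticalPhenomena/PercLowPointHalfSpace` (lands `--supports stmt-CriticalPhenomena-14713`; registered
stub `stub_dyadic` of the skeleton `stem-criterion`, line `SketchIdeator4`, lead a1).

Setting: bond percolation on `ℤ³` at `p_c`, `P = P_{p_c}`, `ℍ = {x | 0 ≤ x 0}`, `U = C_ℍ(0)`.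
Write `W_r = {r e₀ ↔ ∂ℍ inside the cube r e₀ + [-r, r]³}`, `arm_R = {U reaches sup-distance ≥ R}`,
`locFoot_R(ω) = #{g ∈ B_R ∩ ∂ℍ | 0 ↔ g inside B_R ∩ ℍ}` and `L_n(r) = {x ∈ B_n | x₀ = r}`.

From the two inputs
* cube exit: `θ ≤ 6 · P(W_r)` for every `r`;
* level inequality: `P(W_r) ≤ t⁻¹ Σ_{x ∈ L_{2r}(r)} P(0 ↔_ℍ x) + Σ_{x ∈ L_r(r)} P(0 ↔_ℍ x, locFoot_r < t)`
  for `r ≥ 1`, `t > 0`,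
the file proves the DYADIC STEM CRITERION (`stub_dyadic`): for `φ ≥ 0`, `R ≥ 1`,

`θ · R ≤ 6 · [R^{-φ} Σ_{x ∈ B_{4R}} P(0 ↔_ℍ x, arm_R) + Σ_{x ∈ B_{2R}} P(0 ↔_ℍ x, arm_R, locFoot_R < (2R)^φ)]`.

Proof (pure bookkeeping): put `t = (2R)^φ` and sum the two inputs over the `R` levels `r ∈ [R, 2R)`.
Distinct levels give disjoint level boxes, all inside `B_{4R}` (resp. `B_{2R}`); a connection
`0 ↔_ℍ x` with `x₀ = r ≥ R` realises `arm_R`; the local footprint is monotone in the box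
(`locFoot_R ≤ locFoot_r` for `R ≤ r`), so `{locFoot_r < t} ⊆ {locFoot_R < t}`; finally
`t⁻¹ = (2R)^{-φ} ≤ R^{-φ}`.

No percolation theory is used beyond monotonicity of `{x ↔ y in S}` in `S` (`openConnIn_mono`).
-/

noncomputable section

open MeasureTheory Filter Topology
open Literature.Probability.Percolation Literature.Probability.LatticeModels
open scoped ENNReal Classical

namespace Summit.CriticalPhenomena.PercolationContinuityZ3.Theorems.StemCriterion

open Summit.CriticalPhenomena.PercolationContinuityZ3.Theses.PercLowPointHalfSpace

/-- The critical bond percolation measure `P_{p_c}` on `ℤ³` (local notation). -/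
local notation3 (prettyPrint := false) "ℙc" => bondPercolation (zdGraph 3) (criticalProbI 3)

/-- The half-space connection event `U x = {0 ↔_ℍ x}` (local notation). -/
local notation3 (prettyPrint := false) "𝐔[" x "]" =>
  (openConnIn {z : Site 3 | 0 ≤ z 0} 0 x : Set (BondConfig (Site 3)))

/-- The arm event `arm_R = {U reaches sup-distance ≥ R}` (local notation). -/
local notation3 (prettyPrint := false) "𝐚𝐫𝐦[" R "]" =>
  ({ω | ∃ y : Site 3, (∃ i : Fin 3, ((R : ℕ) : ℤ) ≤ |y i|) ∧
    ω ∈ openConnIn {x : Site 3 | 0 ≤ x 0} 0 y} : Set (BondConfig (Site 3)))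

/-- The local footprint `locFoot_R(ω) = #{g ∈ B_R ∩ ∂ℍ | 0 ↔ g inside B_R ∩ ℍ}` (local notation). -/
local notation3 (prettyPrint := false) "𝐥𝐟[" R ", " ω "]" =>
  Finset.card ((box 3 R).filter fun g : Site 3 => g 0 = 0 ∧
    ω ∈ openConnIn ((↑(box 3 R) : Set (Site 3)) ∩ {x : Site 3 | 0 ≤ x 0}) 0 g)

/-- The level box `L_n(r) = {x ∈ B_n | x₀ = r}` (local notation). -/
local notation3 (prettyPrint := false) "𝐋[" n ", " r "]" =>
  ((box 3 n).filter (fun x : Site 3 => x 0 = ((r : ℕ) : ℤ)))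

namespace Dyadic

/-! ## Geometry of boxes and level boxes -/

/-- Boxes are monotone: `B_m ⊆ B_n` for `m ≤ n`. -/
theorem box_subset_box {m n : ℕ} (h : m ≤ n) : (box 3 m : Finset (Site 3)) ⊆ box 3 n := by
  intro x hx
  rw [mem_box] at hx ⊢
  intro i
  have := hx i
  omega

/-- Distinct levels have disjoint level boxes. -/
theorem pairwiseDisjoint_levelBox (S : Finset ℕ) (n : ℕ → ℕ) :
    (↑S : Set ℕ).PairwiseDisjoint fun r => 𝐋[n r, r] := by
  intro r _ r' _ hne
  simp only [Function.onFun]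
  rw [Finset.disjoint_left]
  intro x hx hx'
  rw [Finset.mem_filter] at hx hx'
  exact hne (by have h1 := hx.2; have h2 := hx'.2; omega)

/-- **Regrouping of level sums.** For levels `r ∈ S` with level boxes `L_{n r}(r) ⊆ B_N`, a termwise
bound of the summands by a nonnegative `g` bounds the double sum by the in-box sum `Σ_{x ∈ B_N} g x`
(the level boxes of distinct levels are disjoint). -/
theorem sum_level_le (S : Finset ℕ) (n : ℕ → ℕ) (N : ℕ) (hn : ∀ r ∈ S, n r ≤ N)
    (f : ℕ → Site 3 → ℝ) (g : Site 3 → ℝ) (hg : ∀ x, 0 ≤ g x)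
    (hfg : ∀ r ∈ S, ∀ x ∈ 𝐋[n r, r], f r x ≤ g x) :
    ∑ r ∈ S, ∑ x ∈ 𝐋[n r, r], f r x ≤ ∑ x ∈ box 3 N, g x := by
  have hsub : S.biUnion (fun r => 𝐋[n r, r]) ⊆ box 3 N := by
    intro x hx
    rw [Finset.mem_biUnion] at hx
    obtain ⟨r, hr, hx⟩ := hx
    rw [Finset.mem_filter] at hx
    exact box_subset_box (hn r hr) hx.1
  calc ∑ r ∈ S, ∑ x ∈ 𝐋[n r, r], f r x
      ≤ ∑ r ∈ S, ∑ x ∈ 𝐋[n r, r], g x :=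
        Finset.sum_le_sum fun r hr => Finset.sum_le_sum fun x hx => hfg r hr x hx
    _ = ∑ x ∈ S.biUnion (fun r => 𝐋[n r, r]), g x :=
        (Finset.sum_biUnion (pairwiseDisjoint_levelBox S n)).symm
    _ ≤ ∑ x ∈ box 3 N, g x := Finset.sum_le_sum_of_subset_of_nonneg hsub fun x _ _ => hg x

/-! ## The two event inclusions -/

/-- A half-space connection `0 ↔_ℍ x` to a point with `x₀ ≥ R` realises the arm event `arm_R`
(witness `y = x`, coordinate `i = 0`). -/
theorem openConnIn_subset_arm {R : ℕ} {x : Site 3} (hx : (R : ℤ) ≤ x 0) : 𝐔[x] ⊆ 𝐚𝐫𝐦[R] :=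
  fun _ hω => ⟨x, ⟨0, hx.trans (le_abs_self _)⟩, hω⟩

/-- The local footprint is monotone in the box: `locFoot_R(ω) ≤ locFoot_r(ω)` for `R ≤ r`. -/
theorem locFoot_mono {R r : ℕ} (h : R ≤ r) (ω : BondConfig (Site 3)) : 𝐥𝐟[R, ω] ≤ 𝐥𝐟[r, ω] := by
  refine Finset.card_le_card fun g hg => ?_
  rw [Finset.mem_filter] at hg ⊢
  refine ⟨box_subset_box h hg.1, hg.2.1, openConnIn_mono ?_ 0 g hg.2.2⟩
  exact Set.inter_subset_inter_left _ (Finset.coe_subset.2 (box_subset_box h))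

/-! ## The threshold `t = (2R)^φ` -/

/-- `((2R)^φ)⁻¹ ≤ R^{-φ}` for `φ ≥ 0` and `R ≥ 1`. -/
theorem inv_rpow_two_mul_le {φ : ℝ} (hφ : 0 ≤ φ) {R : ℕ} (hR : 1 ≤ R) :
    ((2 * (R : ℝ)) ^ φ)⁻¹ ≤ (R : ℝ) ^ (-φ) := by
  have hR' : (0 : ℝ) < R := by exact_mod_cast hR
  rw [← Real.rpow_neg (by positivity)]
  exact Real.rpow_le_rpow_of_nonpos hR' (by linarith) (by linarith)

end Dyadic

open Dyadic in
/-- **The dyadic stem criterion** (registered stub `stub_dyadic` of line `SketchIdeator4`): from cube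
exit (`θ ≤ 6 · P(W_r)`, every `r`) and the level inequality
(`P(W_r) ≤ t⁻¹ Σ_{x ∈ L_{2r}(r)} P(0 ↔_ℍ x) + Σ_{x ∈ L_r(r)} P(0 ↔_ℍ x, locFoot_r < t)`, `r ≥ 1`, `t > 0`)
at `p_c`, for `φ ≥ 0` and `R ≥ 1`, summing the levels `r ∈ [R, 2R)` with threshold `t = (2R)^φ`:
`θ(p_c) · R ≤ 6 · [R^{-φ} · Σ_{x ∈ B_{4R}} P(0 ↔_ℍ x, arm_R) + Σ_{x ∈ B_{2R}} P(0 ↔_ℍ x, arm_R, locFoot_R < (2R)^φ)]`. -/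
theorem stub_dyadic : (∀ r : ℕ, theta (zdGraph 3) (0 : Site 3) (criticalProbI 3) ≤ 6 * (bondPercolation (zdGraph 3) (criticalProbI 3)).real {ω | ∃ f : Site 3, f 0 = 0 ∧ ω ∈ openConnIn {y : Site 3 | ∀ i : Fin 3, |y i - (Pi.single 0 (r : ℤ) : Site 3) i| ≤ (r : ℤ)} (Pi.single 0 (r : ℤ) : Site 3) f}) → (∀ r : ℕ, 1 ≤ r → ∀ t : ℝ, 0 < t → (bondPercolation (zdGraph 3) (criticalProbI 3)).real {ω | ∃ f : Site 3, f 0 = 0 ∧ ω ∈ openConnIn {y : Site 3 | ∀ i : Fin 3, |y i - (Pi.single 0 (r : ℤ) : Site 3) i| ≤ (r : ℤ)} (Pi.single 0 (r : ℤ) : Site 3) f} ≤ t⁻¹ * ∑ x ∈ (box 3 (2 * r)).filter (fun x : Site 3 => x 0 = (r : ℤ)), (bondPercolation (zdGraph 3) (criticalProbI 3)).real (openConnIn {x : Site 3 | 0 ≤ x 0} 0 x) + ∑ x ∈ (box 3 r).filter (fun x : Site 3 => x 0 = (r : ℤ)), (bondPercolation (zdGraph 3) (criticalProbI 3)).real (openConnIn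 {x : Site 3 | 0 ≤ x 0} 0 x ∩ {ω | ((((box 3 r).filter fun g : Site 3 => g 0 = 0 ∧ ω ∈ openConnIn ((↑(box 3 r) : Set (Site 3)) ∩ {x : Site 3 | 0 ≤ x 0}) 0 g).card : ℕ) : ℝ) < t})) → ∀ φ : ℝ, 0 ≤ φ → ∀ R : ℕ, 1 ≤ R → theta (zdGraph 3) (0 : Site 3) (criticalProbI 3) * R ≤ 6 * ((R : ℝ) ^ (-φ) * ∑ x ∈ box 3 (4 * R), (bondPercolation (zdGraph 3) (criticalProbI 3)).real (openConnIn {x : Site 3 | 0 ≤ x 0} 0 x ∩ {ω | ∃ y : Site 3, (∃ i : Fin 3, (R : ℤ) ≤ |y i|) ∧ ω ∈ openConnIn {x : Site 3 | 0 ≤ x 0} 0 y}) + ∑ x ∈ box 3 (2 * R), (bondPercolation (zdGraph 3) (criticalProbI 3)).real (openConnIn {x : Site 3 | 0 ≤ x 0} 0 x ∩ {ω | ∃ y : Site 3, (∃ i : Fin 3, (R : ℤ) ≤ |y i|) ∧ ω ∈ openConnIn {x : Site 3 | 0 ≤ x 0} 0 y} ∩ {ω | ((((box 3 R).filter fun g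 : Site 3 => g 0 = 0 ∧ ω ∈ openConnIn ((↑(box 3 R) : Set (Site 3)) ∩ {x : Site 3 | 0 ≤ x 0}) 0 g).card : ℕ) : ℝ) < (2 * (R : ℝ)) ^ φ})) := by
  intro h1 h2 φ hφ R hR
  -- the threshold `t = (2R)^φ > 0`
  have ht : (0 : ℝ) < (2 * (R : ℝ)) ^ φ := Real.rpow_pos_of_pos (by positivity) φ
  -- one level `r ∈ [R, 2R)`: cube exit followed by the level inequality at `t = (2R)^φ`
  have hstep : ∀ r ∈ Finset.Ico R (2 * R), theta (zdGraph 3) (0 : Site 3) (criticalProbI 3) ≤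
      6 * (((2 * (R : ℝ)) ^ φ)⁻¹ * ∑ x ∈ 𝐋[2 * r, r], (ℙc).real 𝐔[x] +
        ∑ x ∈ 𝐋[r, r], (ℙc).real (𝐔[x] ∩ {ω | ((𝐥𝐟[r, ω] : ℕ) : ℝ) < (2 * (R : ℝ)) ^ φ})) := by
    intro r hr
    rw [Finset.mem_Ico] at hr
    exact (h1 r).trans (mul_le_mul_of_nonneg_left (h2 r (by omega) _ ht) (by norm_num))
  -- sum over the `R` levels
  have hsum := Finset.card_nsmul_le_sum _ _ _ hstep
  rw [Nat.card_Ico, show 2 * R - R = R by omega, nsmul_eq_mul, ← Finset.mul_sum,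
    Finset.sum_add_distrib, ← Finset.mul_sum] at hsum
  -- the fat part: levels `≥ R` force `arm_R`, level boxes `L_{2r}(r) ⊆ B_{4R}` are disjoint
  have hA : ∑ r ∈ Finset.Ico R (2 * R), ∑ x ∈ 𝐋[2 * r, r], (ℙc).real 𝐔[x] ≤
      ∑ x ∈ box 3 (4 * R), (ℙc).real (𝐔[x] ∩ 𝐚𝐫𝐦[R]) := by
    refine sum_level_le (Finset.Ico R (2 * R)) (fun r => 2 * r) (4 * R) (fun r hr => ?_)
      (fun _ x => (ℙc).real 𝐔[x]) (fun x => (ℙc).real (𝐔[x] ∩ 𝐚𝐫𝐦[R]))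
      (fun _ => measureReal_nonneg) (fun r hr x hx => ?_)
    · rw [Finset.mem_Ico] at hr
      omega
    · rw [Finset.mem_Ico] at hr
      rw [Finset.mem_filter] at hx
      exact measureReal_mono (Set.subset_inter Set.Subset.rfl
        (openConnIn_subset_arm (by have h1 := hr.1; have h2 := hx.2; omega)))
  -- the thin part: same regrouping in `B_{2R}`, plus `locFoot_R ≤ locFoot_r`
  have hB : ∑ r ∈ Finset.Ico R (2 * R), ∑ x ∈ 𝐋[r, r],
      (ℙc).real (𝐔[x] ∩ {ω | ((𝐥𝐟[r, ω] : ℕ) : ℝ) < (2 * (R : ℝ)) ^ φ}) ≤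
      ∑ x ∈ box 3 (2 * R),
        (ℙc).real (𝐔[x] ∩ 𝐚𝐫𝐦[R] ∩ {ω | ((𝐥𝐟[R, ω] : ℕ) : ℝ) < (2 * (R : ℝ)) ^ φ}) := by
    refine sum_level_le (Finset.Ico R (2 * R)) (fun r => r) (2 * R) (fun r hr => ?_)
      (fun r x => (ℙc).real (𝐔[x] ∩ {ω | ((𝐥𝐟[r, ω] : ℕ) : ℝ) < (2 * (R : ℝ)) ^ φ}))
      (fun x => (ℙc).real (𝐔[x] ∩ 𝐚𝐫𝐦[R] ∩ {ω | ((𝐥𝐟[R, ω] : ℕ) : ℝ) < (2 * (R : ℝ)) ^ φ}))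
      (fun _ => measureReal_nonneg) (fun r hr x hx => ?_)
    · rw [Finset.mem_Ico] at hr
      omega
    · rw [Finset.mem_Ico] at hr
      rw [Finset.mem_filter] at hx
      refine measureReal_mono fun ω hω => ⟨⟨hω.1, ?_⟩, ?_⟩
      · exact openConnIn_subset_arm (by have h1 := hr.1; have h2 := hx.2; omega) hω.1
      · show ((𝐥𝐟[R, ω] : ℕ) : ℝ) < (2 * (R : ℝ)) ^ φ
        have hω2 : ((𝐥𝐟[r, ω] : ℕ) : ℝ) < (2 * (R : ℝ)) ^ φ := hω.2
        exact lt_of_le_of_lt (Nat.cast_le.2 (locFoot_mono hr.1 ω)) hω2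
  -- the threshold: `t⁻¹ = (2R)^{-φ} ≤ R^{-φ}` (and the summed fat part is nonnegative)
  have ht' : ((2 * (R : ℝ)) ^ φ)⁻¹ ≤ (R : ℝ) ^ (-φ) := inv_rpow_two_mul_le hφ hR
  have hSA : (0 : ℝ) ≤ ∑ r ∈ Finset.Ico R (2 * R), ∑ x ∈ 𝐋[2 * r, r], (ℙc).real 𝐔[x] :=
    Finset.sum_nonneg fun _ _ => Finset.sum_nonneg fun _ _ => measureReal_nonneg
  have hmul := mul_le_mul ht' hA hSA (Real.rpow_nonneg (Nat.cast_nonneg R) _)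
  rw [mul_comm (theta (zdGraph 3) (0 : Site 3) (criticalProbI 3)) (R : ℝ)]
  linarith
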